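import Mathlib
import HarnessLib

/-!
# Reduced generating rows of a lattice between `N·ℤⁿ` and `ℤⁿ` (the Hermite-type reduction behind `SatBasisReduced`)

Support file (theorems only; no named facts). Cell `abc-stewartyu`, route `YuMatveevShapeRat` (A1.L), WP-L.P lattice kit
(R25 (3) `SatBasisReduced`; plan ASSIGN / p2 16:22:59Z (A) `SatKit`), seat p1. For an additive subgroup `Λ ≤ ℤⁿ`
containing `N·eⱼ` for every `j` (`N ≥ 1`), there are `n` vectors `v₀, …, v_{n−1} ∈ Λ`, TRIANGULAR (`vᵢ j = 0` for
`j < i`, `0 < vᵢ i ≤ N`) with ALL entries in `[0, N]`, which GENERATE `Λ` over `ℤ` (`x = Σ cᵢ • vᵢ` for every `x ∈ Λ`).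
This is the row Hermite normal form of any basis of `Λ`, obtained without bases: `vᵢ i = dᵢ` is the least positive
`i`-th coordinate on `Λᵢ = {x ∈ Λ : x j = 0 (j < i)}` (so `dᵢ ∣ x i` on `Λᵢ`, and `dᵢ ∣ N`), the later coordinates
are reduced modulo `N` using `N·eⱼ ∈ Λ`, and generation is the descending Euclid recursion. Consumed by
`SatBasisReduced` (the saturated basis `θ` of `⟨α⟩^{sat}` re-based so that `θᵢ^N = ∏ⱼ αⱼ^{Hᵢⱼ}` with
`0 ≤ Hᵢⱼ ≤ N`: `h(θᵢ) ≤ Σⱼ h(αⱼ)`, `Σᵢ |Hᵢⱼ| ≤ n·N`, `|C′ⱼₖ| ≤ (n−1)!·N`).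

## References
* [Cassels1997] J. W. S. Cassels, *An Introduction to the Geometry of Numbers*, Ch. I §2.2 Thm I (triangular basis of a
  sublattice / superlattice). [folklore form]
* [Nesterenko2003] Yu. V. Nesterenko, LNM 1819 (2003) — §3.4 (the lattice `𝔑`, `N𝔑 ⊂ ℤⁿ`).
-/

namespace Summit.ABC.StewartYu

namespace LatticeRows

open Finset Matrix

variable {n : ℕ}

/-- the `i`-th tail subgroup `Λᵢ = {x ∈ Λ : x j = 0 for j < i}`. [folklore] -/
def tail (Λ : AddSubgroup (Fin n → ℤ)) (i : ℕ) : AddSubgroup (Fin n → ℤ) where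
  carrier := {x | x ∈ Λ ∧ ∀ j : Fin n, (j : ℕ) < i → x j = 0}
  add_mem' := by
    rintro a b ⟨ha, ha0⟩ ⟨hb, hb0⟩
    exact ⟨Λ.add_mem ha hb, fun j hj => by simp [ha0 j hj, hb0 j hj]⟩
  zero_mem' := ⟨Λ.zero_mem, fun _ _ => rfl⟩
  neg_mem' := by
    rintro a ⟨ha, ha0⟩
    exact ⟨Λ.neg_mem ha, fun j hj => by simp [ha0 j hj]⟩

/-- membership in the tail subgroup. [folklore] -/
theorem mem_tail {Λ : AddSubgroup (Fin n → ℤ)} {i : ℕ} {x : Fin n → ℤ} :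
    x ∈ tail Λ i ↔ x ∈ Λ ∧ ∀ j : Fin n, (j : ℕ) < i → x j = 0 := Iff.rfl

/-- `N·eⱼ ∈ Λᵢ` for `j ≥ i`. [folklore] -/
theorem single_mem_tail {Λ : AddSubgroup (Fin n → ℤ)} {N : ℤ} (hΛ : ∀ j, Pi.single j N ∈ Λ)
    {i : ℕ} (j : Fin n) (hj : i ≤ (j : ℕ)) : Pi.single j N ∈ tail Λ i := by
  refine ⟨hΛ j, fun k hk => ?_⟩
  have : k ≠ j := by intro h; subst h; omega
  simp [this]

/-- **The reduced row at position `i`.** If `N·eⱼ ∈ Λ` for all `j` (`N ≥ 1`), then for every `i` there is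
`v ∈ Λᵢ` with `0 < v i ≤ N`, `v i ∣ x i` for every `x ∈ Λᵢ`, and `0 ≤ v j ≤ N` for every `j`.
[cite: Cassels1997, Ch. I §2.2 Thm I] -/
theorem exists_reduced_row (Λ : AddSubgroup (Fin n → ℤ)) {N : ℕ} (hN : 0 < N)
    (hΛ : ∀ j, Pi.single j (N : ℤ) ∈ Λ) (i : Fin n) :
    ∃ v : Fin n → ℤ, v ∈ tail Λ i ∧ 0 < v i ∧ v i ≤ N ∧ (∀ x ∈ tail Λ i, v i ∣ x i) ∧
      (∀ j, 0 ≤ v j ∧ v j ≤ N) := by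
  classical
  -- the set of positive `i`-th coordinates on `Λᵢ` is nonempty (`N`)
  have hex : ∃ d : ℕ, 0 < d ∧ ∃ x ∈ tail Λ (i : ℕ), x i = d :=
    ⟨N, hN, Pi.single i (N : ℤ), single_mem_tail hΛ i le_rfl, by simp⟩
  obtain ⟨hdpos, w, hw, hwi⟩ := Nat.find_spec hex
  have hmin : ∀ d' : ℕ, 0 < d' → (∃ x ∈ tail Λ (i : ℕ), x i = d') → Nat.find hex ≤ d' :=
    fun d' h1 h2 => Nat.find_min' hex ⟨h1, h2⟩
  set d : ℕ := Nat.find hex with hd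
  -- `d ∣ x i` on `Λᵢ` (Euclid)
  have hdvd : ∀ x ∈ tail Λ (i : ℕ), (d : ℤ) ∣ x i := by
    intro x hx
    have hd0 : (0 : ℤ) < d := by exact_mod_cast hdpos
    -- `r = x i mod d` is the `i`-th coordinate of `x − q•w ∈ Λᵢ`
    set q := x i / (d : ℤ) with hq
    set r := x i % (d : ℤ) with hr
    have hr0 : 0 ≤ r := Int.emod_nonneg _ hd0.ne'
    have hrd : r < d := Int.emod_lt_of_pos _ hd0
    have hxqr : x i = (d : ℤ) * q + r := by have := Int.emod_def (x i) (d : ℤ); rw [hq, hr]; linarith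
    by_contra hnd
    have hrne : r ≠ 0 := by
      intro h0; apply hnd; rw [hxqr, h0, add_zero]; exact dvd_mul_right _ _
    have hrpos : 0 < r := lt_of_le_of_ne hr0 (Ne.symm hrne)
    -- the vector `x − q • w`
    have hmem : x - q • w ∈ tail Λ (i : ℕ) := (tail Λ i).sub_mem hx ((tail Λ i).zsmul_mem hw q)
    have hcoord : (x - q • w) i = r := by
      simp only [Pi.sub_apply, Pi.smul_apply, smul_eq_mul, hwi]; rw [hxqr]; ring
    have := hmin r.toNat (by omega) ⟨x - q • w, hmem, by rw [hcoord]; omega⟩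
    omega
  -- reduce the coordinates `j > i` modulo `N`
  let v : Fin n → ℤ := fun j => if (i : ℕ) < (j : ℕ) then w j % (N : ℤ) else w j
  have hN0 : (0 : ℤ) < N := by exact_mod_cast hN
  have hv_eq : v = w - ∑ j : Fin n, (if (i : ℕ) < (j : ℕ) then w j / (N : ℤ) else 0) • Pi.single j (N : ℤ) := by
    funext k
    simp only [v, Pi.sub_apply, Finset.sum_apply, Pi.smul_apply, smul_eq_mul]
    rw [Finset.sum_eq_single k]
    · by_cases hk : (i : ℕ) < (k : ℕ)
      · rw [if_pos hk, if_pos hk, Pi.single_eq_same]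
        have := Int.emod_def (w k) (N : ℤ)
        linarith
      · rw [if_neg hk, if_neg hk]; simp
    · intro b _ hb; simp [Ne.symm hb]
    · intro h; exact absurd (Finset.mem_univ k) h
  have hvmem : v ∈ tail Λ (i : ℕ) := by
    rw [hv_eq]
    refine (tail Λ i).sub_mem hw ((tail Λ i).sum_mem fun j _ => ?_)
    by_cases hj : (i : ℕ) < (j : ℕ)
    · rw [if_pos hj]; exact (tail Λ i).zsmul_mem (single_mem_tail hΛ j hj.le) _
    · rw [if_neg hj, zero_smul]; exact (tail Λ i).zero_mem
  have hvi : v i = d := by simp [v, hwi]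
  have hdN : d ≤ N := hmin N hN ⟨Pi.single i (N : ℤ), single_mem_tail hΛ i le_rfl, by simp⟩
  refine ⟨v, hvmem, by rw [hvi]; exact_mod_cast hdpos, by rw [hvi]; exact_mod_cast hdN,
    fun x hx => by rw [hvi]; exact hdvd x hx, fun j => ?_⟩
  by_cases hj : (i : ℕ) < (j : ℕ)
  · have h1 : v j = w j % (N : ℤ) := by show (if (i : ℕ) < (j : ℕ) then w j % (N : ℤ) else w j) = _; rw [if_pos hj]
    rw [h1]
    exact ⟨Int.emod_nonneg _ hN0.ne', (Int.emod_lt_of_pos _ hN0).le⟩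
  · by_cases hji : j = i
    · subst hji; rw [hvi]; exact ⟨by exact_mod_cast hdpos.le, by exact_mod_cast hdN⟩
    · -- `j < i`: the coordinate vanishes
      have hlt : (j : ℕ) < (i : ℕ) := by
        rcases lt_trichotomy (j : ℕ) (i : ℕ) with h | h | h
        · exact h
        · exact absurd (Fin.ext h) hji
        · exact absurd h hj
      have h0 : v j = 0 := by
        have := (mem_tail.mp hvmem).2 j hlt
        exact this
      rw [h0]; exact ⟨le_rfl, by exact_mod_cast hN.le⟩

/-- **Reduced generating rows.** If `N·eⱼ ∈ Λ ≤ ℤⁿ` for all `j` (`N ≥ 1`), there is a matrix `H` of rows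
`Hᵢ ∈ Λ` with `0 ≤ Hᵢⱼ ≤ N`, `Hᵢⱼ = 0` for `j < i`, `0 < Hᵢᵢ`, such that every `x ∈ Λ` is an integer combination
`x = c ᵥ* H` of the rows. [cite: Cassels1997, Ch. I §2.2 Thm I] -/
theorem exists_reduced_rows (Λ : AddSubgroup (Fin n → ℤ)) {N : ℕ} (hN : 0 < N)
    (hΛ : ∀ j, Pi.single j (N : ℤ) ∈ Λ) :
    ∃ H : Matrix (Fin n) (Fin n) ℤ, (∀ i, H i ∈ Λ) ∧ (∀ i j, 0 ≤ H i j ∧ H i j ≤ N) ∧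
      (∀ i j : Fin n, (j : ℕ) < i → H i j = 0) ∧ (∀ i, 0 < H i i) ∧
      (∀ x ∈ Λ, ∃ c : Fin n → ℤ, x = c ᵥ* H) := by
  classical
  choose v hvmem hvpos hvle hvdvd hvbox using exists_reduced_row Λ hN hΛ
  refine ⟨Matrix.of v, fun i => (mem_tail.mp (hvmem i)).1, fun i j => hvbox i j,
    fun i j hj => (mem_tail.mp (hvmem i)).2 j hj, fun i => hvpos i, ?_⟩
  -- generation by descending recursion: `P k : ∀ x ∈ Λ_k, ∃ c, x = Σ_{i ≥ k} c i • v i`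
  suffices hgen : ∀ m : ℕ, ∀ x ∈ tail Λ (n - m), ∃ c : Fin n → ℤ, x = ∑ i, c i • v i by
    intro x hx
    obtain ⟨c, hc⟩ := hgen n x (by rw [Nat.sub_self]; exact ⟨hx, fun j hj => absurd hj (Nat.not_lt_zero _)⟩)
    refine ⟨c, ?_⟩
    rw [hc]; funext k
    simp [Finset.sum_apply, Matrix.vecMul, dotProduct, Matrix.of_apply]
  intro m
  induction m with
  | zero =>
    intro x hx
    refine ⟨0, ?_⟩
    funext k
    have := (mem_tail.mp hx).2 k (by omega)
    simpa using this
  | succ m ih =>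
    intro x hx
    by_cases hm : n ≤ m
    · -- `n - (m+1) = n - m = 0`
      have e1 : n - (m + 1) = n - m := by omega
      rw [e1] at hx; exact ih x hx
    · push Not at hm
      -- the index `k = n - (m+1)`
      have hk : n - (m + 1) < n := by omega
      set k : Fin n := ⟨n - (m + 1), hk⟩ with hkdef
      have hxk : (v k k : ℤ) ∣ x k := hvdvd k x (by simpa [hkdef] using hx)
      obtain ⟨q, hq⟩ := hxk
      have hy : x - q • v k ∈ tail Λ (n - m) := by
        refine ⟨Λ.sub_mem (mem_tail.mp hx).1 (Λ.zsmul_mem (mem_tail.mp (hvmem k)).1 q), fun j hj => ?_⟩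
        simp only [Pi.sub_apply, Pi.smul_apply, smul_eq_mul]
        by_cases hjk : (j : ℕ) < n - (m + 1)
        · rw [(mem_tail.mp hx).2 j hjk, (mem_tail.mp (hvmem k)).2 j (by simpa [hkdef] using hjk)]; ring
        · have hjeq : j = k := by apply Fin.ext; simp [hkdef]; omega
          subst hjeq; rw [hq]; ring
      obtain ⟨c, hc⟩ := ih _ hy
      refine ⟨c + Pi.single k q, ?_⟩
      have : x = (x - q • v k) + q • v k := by abel
      rw [this, hc]
      simp only [Pi.add_apply, add_smul, Finset.sum_add_distrib]
      congr 1
      rw [Finset.sum_eq_single k]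
      · simp
      · intro b _ hb; simp [hb]
      · intro h; exact absurd (Finset.mem_univ k) h

end LatticeRows

end Summit.ABC.StewartYu
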